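import Literature.NumberTheory.CubicFields.SingularZeroTransport
import Mathlib.Combinatorics.Enumerative.DoubleCounting
import HarnessLib

/-!
# Counting forms over `ℤ/qℤ` with a multiple root mod `p`: reduction to the normal form `a ≡ b ≡ 0`

`Proofs`-style file (theorems only). Topic `Literature/NumberTheory/CubicFields`; continues
`SingularZeroTransport.lean` (`singSet`, transport under `SL₂`, `card_singSet_ne_zero`: a nonzero
form over `𝔽_p` with `Disc = 0` has exactly `p − 1` singular zeros `≠ 0`).

Bhargava–Shankar–Tsimerman 2013, proof of Lemmas 11–13 (`p`-adic densities of `T_p(1²1)`,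
`T_p(1³)`, `𝒰_p`, `𝒱_p`): "If a binary cubic form `f` is in `T_p(1²1)` or `T_p(1³)`, then it can
clearly be brought into the form `f(x,y) = ax³ + bx²y + cxy² + dy³` with `a ≡ b ≡ 0 (mod p)`, namely, by
sending the unique multiple root of `f` in `ℙ¹_{𝔽_p}` to the point `(1,0)` via a transformation in
`GL₂(ℤ)`. Of all `f` … that have been rendered in such a form, a proportion of … actually satisfy
the congruence …". This file turns that sentence into a counting identity over the finite ring
`ℤ/qℤ`, `p ∣ q` (used at `q = p²` and `q = 16`): for any property `C` of forms mod `q` invariant under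
`SL₂(ℤ)`,
* `card_filter_singSet_eq` — for a fixed nonzero `v ∈ 𝔽_p²`, the forms `f (mod q)` with `C f` whose
  reduction is nonzero and singular at `v` are equinumerous with those singular at `(1, 0)`, i.e. with
  `a ≡ b ≡ 0 (mod p)` (transport by an `SL₂(ℤ)` matrix with first row `≡ v`);
* **`card_multipleRoot_eq_mul`** — `#{f mod q : f ≢ 0, Disc f ≡ 0 (mod p), C f} = (p + 1) · #{f mod q :
  f ≢ 0 (mod p), a ≡ b ≡ 0 (mod p), C f}` (double counting of pairs (form, nonzero singular zero):
  `p − 1` zeros per form, `p² − 1` nonzero vectors).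
The fibre over the normal form is then counted coefficient by coefficient in
`LocalDensityOdd.lean` (`q = p²`, odd `p`) and `LocalDensityTwo.lean` (`q = 16`).

## References

* M. Bhargava, A. Shankar, J. Tsimerman, *On the Davenport–Heilbronn theorems and second order
  terms*, Invent. Math. 193 (2013) 439–499 = arXiv:1005.0672, proof of Lemmas 11–13 [BhargavaShankarTsimerman2012].
* H. Davenport, H. Heilbronn, *On the density of discriminants of cubic fields. II*, Proc. Roy.
  Soc. London A 322 (1971) 405–420, §4 (Lemma 4, the densities) [DavenportHeilbronn1971].
-/

namespace Literature.NumberTheory.CubicFields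

namespace BinaryCubic

open Finset

section Reduction

variable {p q : ℕ}

/-- Reduction of an integral matrix to `ℤ/qℤ` and then to `ℤ/pℤ` is reduction to `ℤ/pℤ`. [folklore] -/
theorem matrix_map_castHom (hpq : p ∣ q) (γ : Matrix (Fin 2) (Fin 2) ℤ) :
    (γ.map (Int.castRingHom (ZMod q))).map (ZMod.castHom hpq (ZMod p)) = γ.map (Int.castRingHom (ZMod p)) := by
  rw [Matrix.map_map]
  congr 1
  exact congrArg DFunLike.coe (RingHom.ext_int ((ZMod.castHom hpq (ZMod p)).comp (Int.castRingHom (ZMod q)))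
    (Int.castRingHom (ZMod p)))

/-- **Reduction commutes with substitution**: `(f ∘ γ) mod p = (f mod p) ∘ (γ mod p)`. [folklore] -/
theorem map_subst_intMatrix (hpq : p ∣ q) (f : BinaryCubic (ZMod q)) (γ : Matrix (Fin 2) (Fin 2) ℤ) :
    (f.subst (γ.map (Int.castRingHom (ZMod q)))).map (ZMod.castHom hpq (ZMod p)) =
      (f.map (ZMod.castHom hpq (ZMod p))).subst (γ.map (Int.castRingHom (ZMod p))) := by
  rw [map_subst, matrix_map_castHom hpq]

/-- The reduction of a determinant-`1` integral matrix has determinant `1`. [folklore] -/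
theorem det_map_eq_one {R : Type*} [CommRing R] {γ : Matrix (Fin 2) (Fin 2) ℤ} (hγ : γ.det = 1) :
    (γ.map (Int.castRingHom R)).det = 1 := by
  rw [← RingHom.mapMatrix_apply, ← RingHom.map_det, hγ, map_one]

/-- `Disc` is invariant under determinant-`1` substitutions. [folklore] -/
theorem disc_subst_of_det_eq_one {R : Type*} [CommRing R] (f : BinaryCubic R) {γ : Matrix (Fin 2) (Fin 2) R}
    (hγ : γ.det = 1) : (f.subst γ).disc = f.disc := by
  rw [disc_subst, hγ, one_pow, one_mul]

end Reduction

/-! ### The transport for a fixed nonzero vector -/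

section Count

variable {p q : ℕ}

/-- **Transport to the normal form.** Fix `v ≢ 0 (mod p)` and a property `C` of forms mod `q`
invariant under `SL₂(ℤ)`. The forms `f (mod q)` with `C f` whose reduction mod `p` is nonzero and
has `v` as a singular zero are in bijection (substitution by an `SL₂(ℤ)` matrix with first row `≡ v`)
with the forms with `C f`, nonzero reduction and `a ≡ b ≡ 0 (mod p)` (singular at `(1, 0)`).
[cite: BhargavaShankarTsimerman2012, proof of Lemma 12 (sending the multiple root to (1,0) via GL₂(ℤ))] -/
theorem card_filter_singSet_eq (hp : p.Prime) (hpq : p ∣ q) [NeZero q] (C : BinaryCubic (ZMod q) → Prop)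
    (hC : ∀ γ : Matrix (Fin 2) (Fin 2) ℤ, γ.det = 1 → ∀ f : BinaryCubic (ZMod q),
      C (f.subst (γ.map (Int.castRingHom (ZMod q)))) ↔ C f)
    {v : ZMod p × ZMod p} (hv : v ≠ 0) :
    Nat.card {f : BinaryCubic (ZMod q) // f.map (ZMod.castHom hpq (ZMod p)) ≠ 0 ∧ C f ∧
        v ∈ (f.map (ZMod.castHom hpq (ZMod p))).singSet} =
      Nat.card {f : BinaryCubic (ZMod q) // f.map (ZMod.castHom hpq (ZMod p)) ≠ 0 ∧ C f ∧
        (f.map (ZMod.castHom hpq (ZMod p))).a = 0 ∧ (f.map (ZMod.castHom hpq (ZMod p))).b = 0} := by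
  obtain ⟨γ, hdet, hr, hs⟩ := exists_sl2z_row_eq hp (r₀ := v.1) (s₀ := v.2) (by simpa [Prod.ext_iff] using hv)
  set Γ : Matrix (Fin 2) (Fin 2) (ZMod q) := γ.map (Int.castRingHom (ZMod q)) with hΓ
  have hΓdet : IsUnit Γ.det := by rw [hΓ, det_map_eq_one hdet]; exact isUnit_one
  have hδdet : IsUnit (γ.map (Int.castRingHom (ZMod p))).det := by rw [det_map_eq_one hdet]; exact isUnit_one
  have hrow : rowMul (1, 0) (γ.map (Int.castRingHom (ZMod p))) = v := by
    rw [one_zero_rowMul]; ext <;> simp [hr, hs]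
  refine Nat.card_congr ((substEquiv Γ hΓdet).subtypeEquiv fun f => ?_)
  simp only [substEquiv_apply, hΓ, map_subst_intMatrix hpq, ne_eq, subst_eq_zero_iff _ hδdet, hC γ hdet,
    ← one_zero_mem_singSet, mem_singSet_subst_iff _ hδdet, hrow]

/-- In the situation of `card_filter_singSet_eq`, a form singular at `v ≠ 0` has `Disc ≡ 0 (mod p)`,
so the condition `Disc (f mod p) = 0` may be added for free. [folklore] -/
theorem disc_map_eq_zero_of_mem_singSet (hp : p.Prime) (hpq : p ∣ q) {f : BinaryCubic (ZMod q)} {v : ZMod p × ZMod p} (hv : v ≠ 0)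
    (h : v ∈ (f.map (ZMod.castHom hpq (ZMod p))).singSet) : (f.map (ZMod.castHom hpq (ZMod p))).disc = 0 := by
  obtain ⟨γ, hdet, hr, hs⟩ := exists_sl2z_row_eq hp (r₀ := v.1) (s₀ := v.2) (by simpa [Prod.ext_iff] using hv)
  have hδdet : IsUnit (γ.map (Int.castRingHom (ZMod p))).det := by rw [det_map_eq_one hdet]; exact isUnit_one
  refine disc_eq_zero_of_row_mem_singSet _ hδdet ?_
  have : ((γ.map (Int.castRingHom (ZMod p))) 0 0, (γ.map (Int.castRingHom (ZMod p))) 0 1) = v := by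
    ext <;> simp [hr, hs]
  rwa [this]

/-- **The multiple-root count.** For `p ∣ q` and a property `C` of forms mod `q` invariant under
`SL₂(ℤ)`: the number of `f (mod q)` with `C f` whose reduction mod `p` is nonzero of discriminant `0`
(splitting type `(1²1)` or `(1³)`) is `(p + 1)` times the number of `f (mod q)` with `C f`, nonzero
reduction and `a ≡ b ≡ 0 (mod p)`. (Double count the pairs (form, nonzero singular zero mod `p`): each
such form has `p − 1` of them — the nonzero multiples of its unique multiple root — and each of the
`p² − 1` nonzero vectors is carried to `(1, 0)` by `SL₂(ℤ)`.) [cite: BhargavaShankarTsimerman2012, proof of Lemmas 11–12 (the unique multiple root sent to (1,0); proportions read off the normal form)] -/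
theorem card_multipleRoot_eq_mul (hp : p.Prime) (hpq : p ∣ q) [NeZero q] (C : BinaryCubic (ZMod q) → Prop)
    (hC : ∀ γ : Matrix (Fin 2) (Fin 2) ℤ, γ.det = 1 → ∀ f : BinaryCubic (ZMod q),
      C (f.subst (γ.map (Int.castRingHom (ZMod q)))) ↔ C f) :
    Nat.card {f : BinaryCubic (ZMod q) // f.map (ZMod.castHom hpq (ZMod p)) ≠ 0 ∧
        (f.map (ZMod.castHom hpq (ZMod p))).disc = 0 ∧ C f} =
      (p + 1) * Nat.card {f : BinaryCubic (ZMod q) // f.map (ZMod.castHom hpq (ZMod p)) ≠ 0 ∧ C f ∧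
        (f.map (ZMod.castHom hpq (ZMod p))).a = 0 ∧ (f.map (ZMod.castHom hpq (ZMod p))).b = 0} := by
  classical
  haveI : Fact p.Prime := ⟨hp⟩
  set π := ZMod.castHom hpq (ZMod p) with hπ
  -- the two finite sets and the incidence relation
  set s : Finset (BinaryCubic (ZMod q)) := univ.filter fun f => f.map π ≠ 0 ∧ (f.map π).disc = 0 ∧ C f with hsdef
  set t : Finset (ZMod p × ZMod p) := univ.filter fun v => v ≠ 0 with htdef
  set r : BinaryCubic (ZMod q) → ZMod p × ZMod p → Prop := fun f v => v ∈ (f.map π).singSet with hrdef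
  set B := Nat.card {f : BinaryCubic (ZMod q) // f.map π ≠ 0 ∧ C f ∧ (f.map π).a = 0 ∧ (f.map π).b = 0}
    with hBdef
  -- each form of `s` has `p − 1` nonzero singular zeros
  have hm : ∀ f ∈ s, (t.bipartiteAbove r f).card = p - 1 := by
    intro f hf
    simp only [hsdef, mem_filter, mem_univ, true_and] at hf
    rw [bipartiteAbove, htdef, filter_filter, ← Fintype.card_subtype, ← Nat.card_eq_fintype_card]
    have := card_singSet_ne_zero hp (f := f.map π) (by rw [← eq_zero_iff]; exact hf.1) hf.2.1
    rw [← this]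
    exact Nat.card_congr (Equiv.subtypeEquivRight fun v => by simp only [hrdef]; tauto)
  -- each nonzero vector is a singular zero of `B` forms of `s`
  have hn : ∀ v ∈ t, (s.bipartiteBelow r v).card = B := by
    intro v hv
    simp only [htdef, mem_filter, mem_univ, true_and] at hv
    rw [bipartiteBelow, hsdef, filter_filter, ← Fintype.card_subtype, ← Nat.card_eq_fintype_card, hBdef,
      ← card_filter_singSet_eq hp hpq C hC hv]
    refine Nat.card_congr (Equiv.subtypeEquivRight fun f => ?_)
    simp only [hrdef]
    constructor
    · rintro ⟨⟨h0, -, hCf⟩, hsing⟩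
      exact ⟨h0, hCf, hsing⟩
    · rintro ⟨h0, hCf, hsing⟩
      exact ⟨⟨h0, disc_map_eq_zero_of_mem_singSet hp hpq hv hsing, hCf⟩, hsing⟩
  have key := card_mul_eq_card_mul r hm hn
  -- `#t = p² − 1 = (p − 1)(p + 1)`
  have ht : t.card = (p - 1) * (p + 1) := by
    rw [htdef, ← Fintype.card_subtype, Fintype.card_subtype_compl, Fintype.card_prod, ZMod.card,
      Fintype.card_unique, mul_comm (p - 1), ← Nat.sq_sub_sq, one_pow, sq]
  have hs : s.card = Nat.card {f : BinaryCubic (ZMod q) // f.map π ≠ 0 ∧ (f.map π).disc = 0 ∧ C f} := by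
    rw [hsdef, ← Fintype.card_subtype, ← Nat.card_eq_fintype_card]
  rw [ht, mul_assoc] at key
  have hp1 : 0 < p - 1 := Nat.sub_pos_of_lt hp.one_lt
  rw [← hs]
  exact Nat.eq_of_mul_eq_mul_right hp1 (by rw [key, mul_comm])

end Count

end BinaryCubic

end Literature.NumberTheory.CubicFields
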